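import Literature.MathematicalPhysics.QuantumFieldTheory.Balaban1983to89.B8BlockConstantLiftStabilityRec

/-!
# `Balaban1983to89.B8CentreOscDescentRec` — [Balaban1985Averaging] (166)–(167) p. 44 ∕ [Balaban1985RegularSpaces] (1.135) p. 99: POINTWISE MULTISCALE OSCILLATION OF A GAUGE FUNCTION
# UNDER A CELL FROM ITS ADJACENT-CENTRE LETTERS AT EVERY LEVEL — the descent that turns road (B′)'s structural #5 («`‖u₀(Lⁱz) − u₀(Lⁱ(z + e_μ))‖ ≤ b_i`», dag-n05-e ✓p750625 §3) into the
# pointwise hypothesis of this seat's ✓p753816 `B8ExpMeanLogOscFromPointwiseRec`, hence into the (167)-rows `q_i` of the cross-term bound — record tower, centred blocks, odd `L`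

statement-level skeleton of published theorems with citation tags; proofs where landed; nothing here is a claim about the Yang–Mills mass gap

CITATION HEADER (lean-in-tree rule).  Cell `pub-ymgap` (HUMAN RULING D-0062), the N05-REC → K0-road JUNCTION (width seat `pub-ymgap-dag-n07-w3` g13).  [3] = [Balaban1985Averaging] (166)–(167)
p. 44, (180)–(182) p. 46 (bond condition ⇒ block quantity along a contour); [6] = [Balaban1985RegularSpaces] (1.135) p. 99; [I] = [Balaban1987RG1] (0.3) p. 252.  `--kind proof --supports
stmt-QuantumFields-20541` (K0⁷; count-neutral; no definition).  REUSED BY NAME: dag-n05-d's `B8Eq119TwistedAxialRec.{UnderZ, underZ_zero_iff, underZ_one_block, underZ_one_centre, underZ_flmZ,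
underZ_iff_flmZ_eq, iterate_fl_eq_flmZ}`, dag-n05-e's `B8BlockConstantLiftStabilityRec.{underZ_add, underZ_pow_smul}`, `B7Prop2Explicit.{unitaryUnits, unitaryUnits_le_U1}`,
`BlockAveragingZd.{offZ, natAbs_offZ_le}`, `B7Prop1Explicit.e`; SERVES ✓p753816 `B8ExpMeanLogOscFromPointwiseRec.osc_rows_of_pointwise_under` (its `hpt` is §3's conclusion verbatim) — the
twin, for the SECOND factor `u₀`, of ✓p754021 `B8TwoAxialGaugesOscillationRec` (first factor `τ`).

WHY.  The cross-term bound of the junction (✓p747787) wants the (167)-rows `q_i` of Theorem 4's gauge `u₀` in the `uavgZ L 1` currency; what road (B′) delivers (structural #5, dag-n05-e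
✓p750625 `norm_centre_sub_centre_le_of_avgIterZ(_unitaryUnits)`) is the ADJACENT-CENTRE letter at every level, `‖u₀(Lⁱ·a) − u₀(Lⁱ·(a + e_μ))‖ ≤ b_i` (from the averaged bond variables of
the two fields).  THIS FILE descends it to the pointwise multiscale oscillation `‖u(L^{i+1}·z)⁻¹·u(w) − 1‖ ≤ ω·θ^{j−(i+1)}` that ✓p753816 turns into the rows: inside a block the centres
`Lⁿ·a`, `a ∈ B(z)`, are joined to `Lⁿ·(L·z)` by `≤ d·(L−1)∕2` adjacent moves staying in the block (one level costs `d·s·b_n`, `L = 2s+1`), and down the tower the costs telescope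
([3] (180)–(182): bond condition ⇒ block quantity; [6] (1.135)).

WHAT IS PROVED (sorry-free; C⋆-algebra carrier, `u` unitary at the points used).
§1 ★★ `pointwise_osc_of_step_defects` — generic descent: one-level costs `E(n)` (centre of `z` to the centres of its block points) ⇒ `‖u(Lᵗ·z)⁻¹·u(w) − 1‖ ≤ Σ_{m<t} E(m)` for `w` under `z`.
§2 `underZ_one_step_towards` (the centred block is coordinatewise convex), ★★ `norm_centre_block_le_of_adjacent` (in-block telescoping: adjacent-centre letter `b` on `B(z)` ⇒
   `‖u(Lⁿ·a)⁻¹·u(Lⁿ·a′) − 1‖ ≤ (Σ_μ |a′_μ − a_μ|)·b` for `a, a′ ∈ B(z)`), ★ `step_defect_of_adjacent` (`≤ d·s·b`, `L = 2s + 1`).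
§3 ★★★ `pointwise_osc_of_adjacent_centres` — adjacent-centre letters `b(n)` under the cell with `d·s·b(n) ≤ (ω∕2)·θ^{j−(n+1)}`, `θ ≤ 1∕2` ⇒ VERBATIM the hypothesis `hpt` of
   `B8ExpMeanLogOscFromPointwiseRec` for `u`.
HONEST FRAMING: count-neutral helper; lattice-path bookkeeping + a telescoping sum — nothing of [3]∕[6]∕[I] asserted or discharged; the adjacent-centre letters themselves (structural #5 at
the record) are NOT produced here; `HThm4RecSym152PhiE(G)` ∕ `HThm4Rec*` UNDISCHARGED; N07 ∕ N05 NOT discharged; K0⁷ ∕ K1⁹ NOT closed; counts unmoved (typed 28∕28 · discharged 8∕28);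
one finite 𝕋⁴ programme at fixed ε — R4 closes the conditional finite-𝕋⁴ rung `BalabanLadder.UV` only; the YM mass gap (Clay) is NOT proved by any of this; nothing continuum ∕ ℝ⁴ ∕ OS.
No `def`, no `sorry`, no `instance`, no `notation`.
-/

set_option autoImplicit false

noncomputable section

open scoped BigOperators

namespace Literature.MathematicalPhysics.QuantumFieldTheory.Balaban1983to89.B8CentreOscDescentRec

open B7Prop1Explicit hiding Site
open B7Prop1Explicit renaming Site → SiteZ
open B8Eq119TwistedAxialRec (UnderZ underZ_zero_iff underZ_one_block underZ_one_centre underZ_flmZ underZ_iff_flmZ_eq iterate_fl_eq_flmZ flmZ ctrShift_one)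
open B8BlockConstantLiftStabilityRec (underZ_add underZ_pow_smul)
open B7Prop2Explicit (unitaryUnits mem_unitaryUnits unitaryUnits_le_U1)
open BlockAveragingZd (offZ ctrShift natAbs_offZ_le)
open B8Ineq130Rec (fl)

variable {d : ℕ}

/-! ## §0  Bookkeeping -/

/-- A fine site under `z` at depth `t + 1` is under one of the block points `L·z + r` of `z` at depth `t` (nested centred blocks, odd `L`).
[cite: Balaban1987RG1, (0.3) p.252 (bookkeeping)] -/
private theorem exists_block_of_underZ_succ {L : ℕ} (hL : Odd L) {t : ℕ} {z w : SiteZ d} (hw : UnderZ L (t + 1) z w) :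
    ∃ r : Fin d → Fin L, UnderZ L t ((L : ℤ) • z + offZ L r) w := by
  have hx : UnderZ L t (flmZ L t w) w := underZ_flmZ hL t w
  have h1 : flmZ L (t + 1) w = z := (underZ_iff_flmZ_eq hL (t + 1) z w).1 hw
  rw [← iterate_fl_eq_flmZ hL, Function.iterate_succ_apply', iterate_fl_eq_flmZ hL] at h1
  -- `fl (flmZ t w) = z`, i.e. `flmZ t w ∈ B(z)`
  have hB : UnderZ L 1 z (flmZ L t w) := by
    rw [underZ_iff_flmZ_eq hL 1 z, ← B8Eq119TwistedAxialRec.fl_eq_flmZ_one]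
    exact h1
  obtain ⟨s, hs⟩ := hL
  obtain ⟨r, hr⟩ := (B8Eq119TwistedAxialRec.underZ_one_iff_inBlock (by omega : L = 2 * s + 1) z (flmZ L t w)).1 hB
  exact ⟨r, hr ▸ hx⟩

section Main

variable {𝔹 : Type*} [CStarAlgebra 𝔹] [Nontrivial 𝔹]

omit [Nontrivial 𝔹] in
/-- `‖X·Y − 1‖ ≤ ‖X − 1‖ + ‖Y − 1‖` when `‖X‖ ≤ 1`. [folklore] -/
private theorem norm_mul_sub_one_le_add {X Y : 𝔹} (hX : ‖X‖ ≤ 1) : ‖X * Y - 1‖ ≤ ‖X - 1‖ + ‖Y - 1‖ := by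
  have h : X * Y - 1 = X * (Y - 1) + (X - 1) := by noncomm_ring
  rw [h]
  calc ‖X * (Y - 1) + (X - 1)‖ ≤ ‖X * (Y - 1)‖ + ‖X - 1‖ := norm_add_le _ _
    _ ≤ ‖X‖ * ‖Y - 1‖ + ‖X - 1‖ := by gcongr; exact norm_mul_le _ _
    _ ≤ 1 * ‖Y - 1‖ + ‖X - 1‖ := by gcongr
    _ = ‖X - 1‖ + ‖Y - 1‖ := by ring

omit [Nontrivial 𝔹] in
/-- For a unitary `A`, `‖A⁻¹ − 1‖ = ‖A − 1‖`. [folklore] -/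
private theorem norm_inv_sub_one_eq {A : 𝔹ˣ} (hA : A ∈ unitaryUnits 𝔹) : ‖((A⁻¹ : 𝔹ˣ) : 𝔹) - 1‖ = ‖(A : 𝔹) - 1‖ := by
  have hA' : (A : 𝔹) ∈ unitary 𝔹 := (mem_unitaryUnits).1 hA
  have hinv : ((A⁻¹ : 𝔹ˣ) : 𝔹) = star (A : 𝔹) := by
    have h1 : ((A⁻¹ : 𝔹ˣ) : 𝔹) * (A : 𝔹) = 1 := by rw [← Units.val_mul, inv_mul_cancel, Units.val_one]
    calc ((A⁻¹ : 𝔹ˣ) : 𝔹) = ((A⁻¹ : 𝔹ˣ) : 𝔹) * ((A : 𝔹) * star (A : 𝔹)) := by rw [Unitary.mul_star_self_of_mem hA', mul_one]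
      _ = star (A : 𝔹) := by rw [← mul_assoc, h1, one_mul]
  rw [hinv, ← star_one 𝔹, ← star_sub, norm_star, star_one]

/-! ## §1  Generic descent down the tower -/

/-- ★★ **GENERIC DESCENT**: if `u` is unitary under the cell `y` (depth `j`) and, for every `n < j`, every level-`(n+1)` point `z` under `y` and every block point `L·z + r`, the centre
values satisfy `‖u(L^{n+1}·z)⁻¹·u(Lⁿ·(L·z + r)) − 1‖ ≤ E(n)`, then for `t ≤ j`, `z` under `y` at depth `j − t` and every fine `w` under `z`: `‖u(Lᵗ·z)⁻¹·u(w) − 1‖ ≤ Σ_{m<t} E(m)`.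
[cite: Balaban1985RegularSpaces, (1.135) p.99; Balaban1985Averaging, (180)–(182) p.46; Balaban1987RG1, (0.3) p.252] -/
theorem pointwise_osc_of_step_defects {L : ℕ} (hL : Odd L) (u : SiteZ d → 𝔹ˣ) (j : ℕ) (y : SiteZ d)
    (hu : ∀ x, UnderZ L j y x → u x ∈ unitaryUnits 𝔹) (E : ℕ → ℝ)
    (hstep : ∀ n, n < j → ∀ z, UnderZ L (j - (n + 1)) y z → ∀ r : Fin d → Fin L,
      ‖((((u (((L : ℤ) ^ (n + 1)) • z))⁻¹ * u (((L : ℤ) ^ n) • ((L : ℤ) • z + offZ L r)) : 𝔹ˣ)) : 𝔹) - 1‖ ≤ E n) :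
    ∀ t, t ≤ j → ∀ z, UnderZ L (j - t) y z → ∀ w, UnderZ L t z w →
      ‖((((u (((L : ℤ) ^ t) • z))⁻¹ * u w : 𝔹ˣ)) : 𝔹) - 1‖ ≤ ∑ m ∈ Finset.range t, E m := by
  intro t
  induction t with
  | zero =>
    intro _ z _ w hw
    rw [(underZ_zero_iff L z w).1 hw, pow_zero, one_smul, inv_mul_cancel, Units.val_one, sub_self, norm_zero, Finset.range_zero, Finset.sum_empty]
  | succ t ih =>
    intro ht z hz w hw
    have htj : t < j := by omega
    have hdepth : j - (t + 1) + 1 = j - t := by omega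
    obtain ⟨r, hr⟩ := exists_block_of_underZ_succ hL hw
    have hxr : UnderZ L (j - t) y ((L : ℤ) • z + offZ L r) := by
      obtain ⟨s, hs⟩ := hL
      have h := underZ_add ⟨s, hs⟩ hz (underZ_one_block (by omega : L = 2 * s + 1) z r); rwa [hdepth] at h
    have hcr : UnderZ L j y (((L : ℤ) ^ t) • ((L : ℤ) • z + offZ L r)) := by
      have h := underZ_add hL hxr (underZ_pow_smul L t ((L : ℤ) • z + offZ L r))
      have e : j - t + t = j := by omega
      rwa [e] at h
    have hc : UnderZ L j y (((L : ℤ) ^ (t + 1)) • z) := by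
      have h := underZ_add hL hz (underZ_pow_smul L (t + 1) z)
      have e : j - (t + 1) + (t + 1) = j := by omega
      rwa [e] at h
    have h1 := hstep t htj z hz r
    have h2 := ih htj.le _ hxr w hr
    have hU : (u (((L : ℤ) ^ (t + 1)) • z))⁻¹ * u (((L : ℤ) ^ t) • ((L : ℤ) • z + offZ L r)) ∈ unitaryUnits 𝔹 :=
      (unitaryUnits 𝔹).mul_mem ((unitaryUnits 𝔹).inv_mem (hu _ hc)) (hu _ hcr)
    have hsplit : (u (((L : ℤ) ^ (t + 1)) • z))⁻¹ * u w =
        ((u (((L : ℤ) ^ (t + 1)) • z))⁻¹ * u (((L : ℤ) ^ t) • ((L : ℤ) • z + offZ L r))) *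
          ((u (((L : ℤ) ^ t) • ((L : ℤ) • z + offZ L r)))⁻¹ * u w) := by group
    rw [hsplit, Units.val_mul, Finset.sum_range_succ]
    refine (norm_mul_sub_one_le_add (unitaryUnits_le_U1 hU).1).trans ?_
    linarith

/-! ## §2  Inside one block: adjacent-centre letters give the one-level cost -/

/-- The centred block `B(z)` is coordinatewise convex: from `a ∈ B(z)` one step towards `a′ ∈ B(z)` in a coordinate where they differ stays in `B(z)`. [cite: Balaban1987RG1, (0.3) p.252 (bookkeeping)] -/
theorem underZ_one_step_towards {L : ℕ} {z a a' : SiteZ d} (ha : UnderZ L 1 z a) (ha' : UnderZ L 1 z a') {μ : Fin d} (hμ : a μ < a' μ) :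
    UnderZ L 1 z (a + e μ) := by
  intro i
  have h1 := ha i
  have h2 := ha' i
  by_cases hi : i = μ
  · subst hi
    simp only [Pi.add_apply, e_apply, if_true]
    constructor <;> omega
  · simp only [Pi.add_apply, e_apply, hi, if_false, add_zero]
    exact h1

/-- ★★ **IN-BLOCK TELESCOPING**: if `u(Lⁿ·a)` is unitary for `a ∈ B(z)` and adjacent centres in `B(z)` satisfy `‖u(Lⁿ·a)⁻¹·u(Lⁿ·(a + e_μ)) − 1‖ ≤ b`, then for all `a, a′ ∈ B(z)`:
`‖u(Lⁿ·a)⁻¹·u(Lⁿ·a′) − 1‖ ≤ (Σ_μ |a′_μ − a_μ|)·b` (walk coordinatewise from `a` to `a′` inside the block). [cite: Balaban1985Averaging, (180)–(182) p.46; Balaban1987RG1, (0.3) p.252] -/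
theorem norm_centre_block_le_of_adjacent {L : ℕ} (u : SiteZ d → 𝔹ˣ) (n : ℕ) (z : SiteZ d) {b : ℝ}
    (hu : ∀ a, UnderZ L 1 z a → u (((L : ℤ) ^ n) • a) ∈ unitaryUnits 𝔹)
    (hadj : ∀ a (μ : Fin d), UnderZ L 1 z a → UnderZ L 1 z (a + e μ) →
      ‖((((u (((L : ℤ) ^ n) • a))⁻¹ * u (((L : ℤ) ^ n) • (a + e μ)) : 𝔹ˣ)) : 𝔹) - 1‖ ≤ b) :
    ∀ (N : ℕ) (a a' : SiteZ d), UnderZ L 1 z a → UnderZ L 1 z a' → ∑ μ, (a' μ - a μ).natAbs = N →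
      ‖((((u (((L : ℤ) ^ n) • a))⁻¹ * u (((L : ℤ) ^ n) • a') : 𝔹ˣ)) : 𝔹) - 1‖ ≤ N * b := by
  intro N
  induction N with
  | zero =>
    intro a a' _ _ hN
    have haa : a' = a := by
      funext μ
      have h := (Finset.sum_eq_zero_iff_of_nonneg fun i _ => Nat.zero_le _).1 hN μ (Finset.mem_univ μ)
      have : a' μ - a μ = 0 := Int.natAbs_eq_zero.1 h
      linarith
    rw [haa, inv_mul_cancel, Units.val_one, sub_self, norm_zero, Nat.cast_zero, zero_mul]
  | succ N ih =>
    intro a a' ha ha' hN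
    -- a coordinate where `a` and `a′` differ
    have hex : ∃ μ, a' μ ≠ a μ := by
      by_contra h
      have h' : ∀ μ, a' μ = a μ := fun μ => Classical.byContradiction fun hne => h ⟨μ, hne⟩
      have : ∑ μ, (a' μ - a μ).natAbs = 0 := Finset.sum_eq_zero fun μ _ => by rw [h' μ, sub_self, Int.natAbs_zero]
      omega
    obtain ⟨μ, hμ⟩ := hex
    -- split the sum at `μ`
    have hsplit : ∀ c : SiteZ d, ∑ ν, (a' ν - c ν).natAbs = (a' μ - c μ).natAbs + ∑ ν ∈ Finset.univ.erase μ, (a' ν - c ν).natAbs := by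
      intro c; rw [← Finset.add_sum_erase _ _ (Finset.mem_univ μ)]
    rcases lt_or_gt_of_ne hμ with hlt | hgt
    · -- `a′ μ < a μ`: step `a′ ↦ a′ + e μ` towards `a` … we instead step `a` down: use the symmetric move on `a′`
      -- move `a′` one step up towards `a`: `a″ := a′ + e μ ∈ B(z)`
      have ha'' : UnderZ L 1 z (a' + e μ) := underZ_one_step_towards ha' ha hlt
      have hN' : ∑ ν, ((a' + e μ) ν - a ν).natAbs = N := by
        rw [hsplit a] at hN
        rw [← Finset.add_sum_erase _ _ (Finset.mem_univ μ)]
        have h1 : ((a' + e μ) μ - a μ).natAbs + 1 = (a' μ - a μ).natAbs := by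
          simp only [Pi.add_apply, e_apply, if_true]; omega
        have h2 : ∑ ν ∈ Finset.univ.erase μ, ((a' + e μ) ν - a ν).natAbs = ∑ ν ∈ Finset.univ.erase μ, (a' ν - a ν).natAbs := by
          refine Finset.sum_congr rfl fun ν hν => ?_
          have hνμ : ν ≠ μ := Finset.ne_of_mem_erase hν
          simp only [Pi.add_apply, e_apply, hνμ, if_false, add_zero]
        omega
      have hih := ih a (a' + e μ) ha ha'' hN'
      -- the last step back: `u(Lⁿ(a′+e μ))⁻¹ u(Lⁿ a′)` is the INVERSE of an adjacent step
      have hlast : ‖((((u (((L : ℤ) ^ n) • (a' + e μ)))⁻¹ * u (((L : ℤ) ^ n) • a') : 𝔹ˣ)) : 𝔹) - 1‖ ≤ b := by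
        have h := hadj a' μ ha' ha''
        have hU : (u (((L : ℤ) ^ n) • a'))⁻¹ * u (((L : ℤ) ^ n) • (a' + e μ)) ∈ unitaryUnits 𝔹 :=
          (unitaryUnits 𝔹).mul_mem ((unitaryUnits 𝔹).inv_mem (hu _ ha')) (hu _ ha'')
        rw [← norm_inv_sub_one_eq hU, mul_inv_rev, inv_inv] at h
        exact h
      have hU1 : (u (((L : ℤ) ^ n) • a))⁻¹ * u (((L : ℤ) ^ n) • (a' + e μ)) ∈ unitaryUnits 𝔹 :=
        (unitaryUnits 𝔹).mul_mem ((unitaryUnits 𝔹).inv_mem (hu _ ha)) (hu _ ha'')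
      have hprod : (u (((L : ℤ) ^ n) • a))⁻¹ * u (((L : ℤ) ^ n) • a') =
          ((u (((L : ℤ) ^ n) • a))⁻¹ * u (((L : ℤ) ^ n) • (a' + e μ))) * ((u (((L : ℤ) ^ n) • (a' + e μ)))⁻¹ * u (((L : ℤ) ^ n) • a')) := by group
      rw [hprod, Units.val_mul, Nat.cast_succ, add_mul, one_mul]
      exact (norm_mul_sub_one_le_add (unitaryUnits_le_U1 hU1).1).trans (add_le_add hih hlast)
    · -- `a μ < a′ μ`: step `a ↦ a + e μ`
      have ha1 : UnderZ L 1 z (a + e μ) := underZ_one_step_towards ha ha' hgt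
      have hN' : ∑ ν, (a' ν - (a + e μ) ν).natAbs = N := by
        rw [hsplit a] at hN
        rw [hsplit (a + e μ)]
        have h1 : (a' μ - (a + e μ) μ).natAbs + 1 = (a' μ - a μ).natAbs := by
          simp only [Pi.add_apply, e_apply, if_true]; omega
        have h2 : ∑ ν ∈ Finset.univ.erase μ, (a' ν - (a + e μ) ν).natAbs = ∑ ν ∈ Finset.univ.erase μ, (a' ν - a ν).natAbs := by
          refine Finset.sum_congr rfl fun ν hν => ?_
          have hνμ : ν ≠ μ := Finset.ne_of_mem_erase hν
          simp only [Pi.add_apply, e_apply, hνμ, if_false, add_zero]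
        omega
      have hih := ih (a + e μ) a' ha1 ha' hN'
      have hfirst := hadj a μ ha ha1
      have hU1 : (u (((L : ℤ) ^ n) • a))⁻¹ * u (((L : ℤ) ^ n) • (a + e μ)) ∈ unitaryUnits 𝔹 :=
        (unitaryUnits 𝔹).mul_mem ((unitaryUnits 𝔹).inv_mem (hu _ ha)) (hu _ ha1)
      have hprod : (u (((L : ℤ) ^ n) • a))⁻¹ * u (((L : ℤ) ^ n) • a') =
          ((u (((L : ℤ) ^ n) • a))⁻¹ * u (((L : ℤ) ^ n) • (a + e μ))) * ((u (((L : ℤ) ^ n) • (a + e μ)))⁻¹ * u (((L : ℤ) ^ n) • a')) := by group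
      rw [hprod, Units.val_mul, Nat.cast_succ, add_mul, one_mul]
      refine (norm_mul_sub_one_le_add (unitaryUnits_le_U1 hU1).1).trans ?_
      linarith

/-- ★ **THE ONE-LEVEL COST FROM THE ADJACENT-CENTRE LETTER**: `‖u(L^{n+1}·z)⁻¹·u(Lⁿ·(L·z + r)) − 1‖ ≤ d·s·b` (`L = 2s + 1`; the block point is `≤ s` steps from the centre in each of
the `d` coordinates). [cite: Balaban1985Averaging, (167) p.44, (180)–(182) p.46; Balaban1987RG1, (0.3) p.252] -/
theorem step_defect_of_adjacent {L s : ℕ} (hLs : L = 2 * s + 1) (u : SiteZ d → 𝔹ˣ) (n : ℕ) (z : SiteZ d) {b : ℝ} (hb : 0 ≤ b)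
    (hu : ∀ a, UnderZ L 1 z a → u (((L : ℤ) ^ n) • a) ∈ unitaryUnits 𝔹)
    (hadj : ∀ a (μ : Fin d), UnderZ L 1 z a → UnderZ L 1 z (a + e μ) →
      ‖((((u (((L : ℤ) ^ n) • a))⁻¹ * u (((L : ℤ) ^ n) • (a + e μ)) : 𝔹ˣ)) : 𝔹) - 1‖ ≤ b) (r : Fin d → Fin L) :
    ‖((((u (((L : ℤ) ^ (n + 1)) • z))⁻¹ * u (((L : ℤ) ^ n) • ((L : ℤ) • z + offZ L r)) : 𝔹ˣ)) : 𝔹) - 1‖ ≤ (d : ℝ) * s * b := by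
  have hc : ((L : ℤ) ^ (n + 1)) • z = ((L : ℤ) ^ n) • ((L : ℤ) • z) := by rw [smul_smul, ← pow_succ]
  rw [hc]
  have hN : ∑ μ, (((L : ℤ) • z + offZ L r) μ - ((L : ℤ) • z) μ).natAbs ≤ d * s := by
    calc ∑ μ, (((L : ℤ) • z + offZ L r) μ - ((L : ℤ) • z) μ).natAbs = ∑ μ : Fin d, (offZ L r μ).natAbs := by
          refine Finset.sum_congr rfl fun μ _ => ?_; simp
      _ ≤ ∑ _μ : Fin d, s := Finset.sum_le_sum fun μ _ => natAbs_offZ_le hLs r μ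
      _ = d * s := by simp
  have h := norm_centre_block_le_of_adjacent u n z hu hadj _ _ _ (underZ_one_centre L z) (underZ_one_block hLs z r) rfl
  refine h.trans ?_
  have : ((∑ μ, (((L : ℤ) • z + offZ L r) μ - ((L : ℤ) • z) μ).natAbs : ℕ) : ℝ) ≤ (d : ℝ) * s := by exact_mod_cast hN
  exact mul_le_mul_of_nonneg_right this hb

/-! ## §3  Geometric adjacent-centre letters give the pointwise hypothesis of `B8ExpMeanLogOscFromPointwiseRec` -/

/-- A geometric tail: `Σ_{m<t} θ^{j−(m+1)} ≤ 2·θ^{j−t}` for `t ≤ j`, `0 ≤ θ ≤ 1∕2`. [folklore] -/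
private theorem sum_geom_tail_le {θ : ℝ} (hθ0 : 0 ≤ θ) (hθ : θ ≤ 1 / 2) (j : ℕ) :
    ∀ t, t ≤ j → ∑ m ∈ Finset.range t, θ ^ (j - (m + 1)) ≤ 2 * θ ^ (j - t)
  | 0, _ => by rw [Finset.range_zero, Finset.sum_empty]; positivity
  | t + 1, ht => by
    have h := sum_geom_tail_le hθ0 hθ j t (Nat.le_of_succ_le ht)
    have hpow : θ ^ (j - t) = θ * θ ^ (j - (t + 1)) := by
      rw [← pow_succ', show j - (t + 1) + 1 = j - t by omega]
    rw [Finset.sum_range_succ]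
    have h0 : 0 ≤ θ ^ (j - (t + 1)) := pow_nonneg hθ0 _
    nlinarith

/-- ★★★ **THE POINTWISE HYPOTHESIS `hpt` OF `B8ExpMeanLogOscFromPointwiseRec` FOR `u`, FROM GEOMETRIC ADJACENT-CENTRE LETTERS** (record tower, `L = 2s + 1`): if `u` is unitary under the
cell `y` (depth `j`) and, for every `n < j` and every level-`(n+1)` point `z` under `y`, adjacent centres in `B(z)` satisfy `‖u(Lⁿ·a)⁻¹·u(Lⁿ·(a + e_μ)) − 1‖ ≤ b(n)` with
`d·s·b(n) ≤ (ω∕2)·θ^{j−(n+1)}`, `0 ≤ θ ≤ 1∕2`, then `‖u(L^{i+1}·z)⁻¹·u(w) − 1‖ ≤ ω·θ^{j−(i+1)}` for every `i < j`, `z` under `y` at depth `j − (i+1)` and fine `w` under `z`.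
[cite: Balaban1985Averaging, (166)–(167) p.44, (180)–(182) p.46; Balaban1985RegularSpaces, (1.135) p.99; Balaban1987RG1, (0.3) p.252] -/
theorem pointwise_osc_of_adjacent_centres {L s : ℕ} (hLs : L = 2 * s + 1) (u : SiteZ d → 𝔹ˣ) (j : ℕ) (y : SiteZ d)
    (hu : ∀ x, UnderZ L j y x → u x ∈ unitaryUnits 𝔹) (b : ℕ → ℝ) (hb : ∀ n, 0 ≤ b n) {ω θ : ℝ} (hθ0 : 0 ≤ θ) (hθ : θ ≤ 1 / 2) (hω0 : 0 ≤ ω)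
    (hadj : ∀ n, n < j → ∀ z, UnderZ L (j - (n + 1)) y z → ∀ a (μ : Fin d), UnderZ L 1 z a → UnderZ L 1 z (a + e μ) →
      ‖((((u (((L : ℤ) ^ n) • a))⁻¹ * u (((L : ℤ) ^ n) • (a + e μ)) : 𝔹ˣ)) : 𝔹) - 1‖ ≤ b n)
    (hgeom : ∀ n, n < j → (d : ℝ) * s * b n ≤ ω / 2 * θ ^ (j - (n + 1))) :
    ∀ i, i < j → ∀ z, UnderZ L (j - (i + 1)) y z → ∀ w, UnderZ L (i + 1) z w →
      ‖((((u (((L : ℤ) ^ (i + 1)) • z))⁻¹ * u w : 𝔹ˣ)) : 𝔹) - 1‖ ≤ ω * θ ^ (j - (i + 1)) := by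
  have hL : Odd L := ⟨s, hLs⟩
  -- unitarity of `u` at the level-`n` centres of the block of a level-`(n+1)` point `z` under `y`
  have huz : ∀ n, n < j → ∀ z, UnderZ L (j - (n + 1)) y z → ∀ a, UnderZ L 1 z a → u (((L : ℤ) ^ n) • a) ∈ unitaryUnits 𝔹 := by
    intro n hn z hz a ha
    have hdepth : j - (n + 1) + 1 = j - n := by omega
    have h1 : UnderZ L (j - n) y a := by have h := underZ_add hL hz ha; rwa [hdepth] at h
    have h2 := underZ_add hL h1 (underZ_pow_smul L n a)
    have e' : j - n + n = j := by omega
    rw [e'] at h2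
    exact hu _ h2
  have hstep : ∀ n, n < j → ∀ z, UnderZ L (j - (n + 1)) y z → ∀ r : Fin d → Fin L,
      ‖((((u (((L : ℤ) ^ (n + 1)) • z))⁻¹ * u (((L : ℤ) ^ n) • ((L : ℤ) • z + offZ L r)) : 𝔹ˣ)) : 𝔹) - 1‖ ≤ (d : ℝ) * s * b n :=
    fun n hn z hz r => step_defect_of_adjacent hLs u n z (hb n) (huz n hn z hz) (hadj n hn z hz) r
  intro i hij z hz w hw
  have h := pointwise_osc_of_step_defects hL u j y hu (fun n => (d : ℝ) * s * b n) hstep (i + 1) hij z hz w hw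
  refine h.trans ?_
  calc ∑ m ∈ Finset.range (i + 1), (d : ℝ) * s * b m
      ≤ ∑ m ∈ Finset.range (i + 1), ω / 2 * θ ^ (j - (m + 1)) :=
        Finset.sum_le_sum fun m hm => hgeom m (lt_of_lt_of_le (Finset.mem_range.1 hm) hij)
    _ = ω / 2 * ∑ m ∈ Finset.range (i + 1), θ ^ (j - (m + 1)) := by rw [Finset.mul_sum]
    _ ≤ ω / 2 * (2 * θ ^ (j - (i + 1))) :=
        mul_le_mul_of_nonneg_left (sum_geom_tail_le hθ0 hθ j (i + 1) hij) (by positivity)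
    _ = ω * θ ^ (j - (i + 1)) := by ring

end Main

end Literature.MathematicalPhysics.QuantumFieldTheory.Balaban1983to89.B8CentreOscDescentRec

end
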